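import Summits.Ventures.AbcSig.Recipes.EisPackage

/-!
# Venture AbcSig — the Serre level at 2 in case (v) with `ord₂ B = 6`, `b` even (ERRATA E3) as a NAMED HYPOTHESIS

HONEST FRAMING. Interface + glue file of a COMPUTATION cell (`pub-abcsig`). No Diophantine statement is proved here and
nothing is a claim on ABC or any summit. `NewformModel.BS04Package` types [BS04, Lemma 3.3] with the level of [BS04,
Lemma 3.2] AS PRINTED: in case (v) with `ord₂(B bⁿ) ≥ 7` (`FreyCase.v₇`) the level is `2 · (odd part)`. The cell's referee
record `referee/E3-LEVEL-LEMMA.md` (ERRATA E3 widened; SIGNED 2026-08-22T07:50:11Z, ref-g4; lead RULING X-7′) shows from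
printed facts that when `t := ord₂ B ≡ 6 (mod n)` — for `n`-th-power-free `B` and `n ≥ 7` that is `t = 6`, the datum then
being in case (v₇) exactly when `b` is even — the mod-`n` representation `ρ^E_n` of `E₃` is UNRAMIFIED at `2`, so its Serre
conductor, and with it the level delivered by level lowering, is the ODD part of `N_n^E`; the rows of record for the classes
`a = 6` / `α = 6` accordingly treat the printed level `2 · (odd part)` as INFORMATIONAL and sieve decisively at the odd level.
The Lean rows so far followed the printed reading and therefore carried the survivors of the informational level as CITED
hypotheses with no certificate of record (citation-backing audit `plean/g5/THETAVERIFY-RECORD.md` Part C, class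
INFORMATIONAL-LEVEL: 11 pairs in 4 cells). This file lets a row use the odd level for that sub-class instead:

* `NewformModel.E3Package` — **CITED NAMED HYPOTHESIS.** For a standing datum `S` in case (v₇) ([BS04, Lemma 3.3]
  hypotheses: positive coefficients, `C` squarefree, prime `n ≥ 7`, `n ∤ ABC`, `A, B` `n`-th-power free, a primitive
  solution with `ab ≠ ±1`, `2⁷ ∣ B bⁿ`, `c ≡ C (mod 4)`) with `ord₂ B = 6` EXACTLY, `ρ^E_n` arises from a newform of level
  `bs04OddLevel A B C n = ∏_{p ∣ C, p odd, p ≠ n} p² · ∏_{q ∣ AB, q odd, q ≠ n} q` (the printed level with its factor `2`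
  removed). Printed inputs (for the intended model), as assembled in the referee record: [BS04, Lemma 2.1 (a),(b)]
  (`Δ(E₃) = 2⁻¹² C³ B² A (a b²)ⁿ`; multiplicative reduction at `2` when `ord₂(B bⁿ) ≥ 7`; the model `E₃` has odd `c₄` there,
  hence is minimal at `2` [Silverman, AEC VII.1.3]), so `ord₂ Δ_min = 2t − 12 + 2n·ord₂ b ≡ 2(t − 6) ≡ 0 (mod n)`; the Tate
  curve [Silverman, ATAEC V.5.3/V.5.4, V.3.1(d), V.6.1]: `n ∣ v₂(Δ_min)` makes `ρ̄_{E,n}|I₂` trivial (`ℚ₂(μ_n, q^{1/n})` is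
  unramified when `q = 2^{nk}·u`), so the Serre conductor exponent at `2` is `0` [Serre 1987, Duke 54, §1.2]; then [BS04,
  Lemma 3.3]'s own proof (modularity [BCDT], irreducibility [BS04, Cor. 3.1] with the [BVY04] caveat at `n = 7`, level
  lowering [Ribet] / [Diamond 1995, "The refined conjecture of Serre", Thm 6.4 = BS04's ref. 21]) gives a newform of level
  `N(ρ̄)` = the odd part of `N_n^E`, i.e. `bs04OddLevel A B C n` for `n ∤ ABC`. (BS04 p. 31 applies the same removal of
  `2` in its `2 ∤ B` branch; only the arithmetic step "n ∤ ord₂ B ⇒ n ∤ ord₂ Δ" fails when `ord₂ B ≡ 6 (mod n)`, as the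
  referee record explains; the printed verdicts of [BS04] are unaffected.) CITED, never proved here; rows take
  `(hE3 : M.E3Package)`. The trace congruences at the odd primes for such an `f` come from `BS04Package` clause (2)
  (stated there for every level `N` and every `f` with `M.Arises S N f`), those at the prime `2` from `Q2Package`.
* Glue (PROVED here): `NewformModel.xno_solution_in_caseE3` — the analogue of `Rows/XTemplateB.lean`'s
  `xno_solution_in_case` for this sub-class: `BS04Package` + `E3Package` + complete orbit data at the ODD level + per-orbit
  (kernel certificate ∨ cited exclusion ∨ standing-datum exclusion) ⇒ no such datum.

References: [BS04] Bennett–Skinner, Canad. J. Math. 56 (2004), Lemma 2.1, Lemma 3.2, Lemma 3.3, Cor. 3.1, p. 31; J. H.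
Silverman, AEC (GTM 106) VII.1.3, ATAEC (GTM 151) V.3.1, V.5.3, V.5.4, V.6.1; J.-P. Serre, Duke Math. J. 54 (1987) §1.2;
F. Diamond, "The refined conjecture of Serre" (1995), Thm 6.4; cell records `referee/E3-LEVEL-LEMMA.md` (statement, two-line
proof, worked example), lead RULING X-7′ (PLAN §10), the rows of record of the cells C1b-C15/17/19-a6 and T13-C2a-l59-a6 (R3:
"class b-even, t = 6 [E3-dependent]: printed recipe → 2·core [E3]; Serre level → core (decisive)").
-/

namespace Summit.Ventures.AbcSig

/-- **NAMED HYPOTHESIS (CITED) — ERRATA E3 / referee record E3-LEVEL-LEMMA: the level-lowered newform sits at the ODD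
level when `ord₂ B = 6` and `b` is even.** For a standing datum `S` in case (v₇) with `OrdTwoEq S.B 6`, and every `N`
equal to `bs04OddLevel S.A S.B S.C S.n`, some newform `f` of level `N` has `M.Arises S N f`. See the module docstring
for the printed inputs. CITED, never proved here. -/
def NewformModel.E3Package (M : NewformModel) : Prop :=
  ∀ S : FreyDatum, Standing S .v₇ → OrdTwoEq (S.B : ℤ) 6 →
    ∀ N : ℕ, bs04OddLevel S.A S.B S.C S.n = N → ∃ f : M.Form N, M.Arises S N f

/-- **Glue for the E3 sub-class.** A standing datum in case (v₇) with `ord₂ B = 6`, complete orbit data at the odd level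
`N = bs04OddLevel A B C n`, and for every listed orbit well-formed entries together with (a kernel sieve certificate at
`n`) ∨ (a cited exclusion for a family containing the datum) ∨ (a standing-datum exclusion at `n`) — contradiction.
`BS04Package` supplies the trace congruences (clause (2), any level), `E3Package` the newform at the odd level. -/
theorem NewformModel.xno_solution_in_caseE3 (M : NewformModel) (hP : M.BS04Package) (hE3 : M.E3Package)
    (S : FreyDatum) (N : ℕ) (hA : 0 < S.A) (hB : 0 < S.B) (hC : 0 < S.C) (hsq : Squarefree S.C) (hn : S.n.Prime)
    (h7 : 7 ≤ S.n) (hndvd : ¬ S.n ∣ S.A * S.B * S.C) (hfree : ∀ q : ℕ, q.Prime → ¬ q ^ S.n ∣ S.A ∧ ¬ q ^ S.n ∣ S.B)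
    (hsol : IsPrimitiveSolution S.A S.B S.C S.n S.a S.b S.c) (hab1 : S.a * S.b ≠ 1) (hab2 : S.a * S.b ≠ -1)
    (hcase : FreyCase.v₇.Holds S.A S.B S.C S.n S.a S.b S.c) (hB6 : OrdTwoEq (S.B : ℤ) 6)
    (hN : bs04OddLevel S.A S.B S.C S.n = N) {orbs : List OrbitData} (hD : M.DataComplete N orbs)
    (fam : FreyDatum → Prop) (hfam : fam S)
    (hS : ∀ o ∈ orbs, (∀ e ∈ o.coeffs, e.ell.Prime ∧ e.ell ≠ 2 ∧ ¬ e.ell ∣ N) ∧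
      (o.Eliminated bs04Allowed S.n ∨ (M.Excludes N o fam ∨ M.ExcludesStd N o S.n))) : False := by
  have hstd : Standing S .v₇ := ⟨hA, hB, hC, hsq, hn, h7, hndvd, hfree, hsol, hab1, hab2, hcase⟩
  obtain ⟨-, hmod⟩ := hP S .v₇ hA hB hC hsq hn h7 hndvd hfree hsol hab1 hab2 hcase
  obtain ⟨f, hf⟩ := hE3 S hstd hB6 N hN
  obtain ⟨o, ho, hfo⟩ := hD f
  obtain ⟨hgood, h⟩ := hS o ho
  rcases h with helim | hex | hst
  · exact M.not_arisesMod_of_eliminated f o hfo S.n bs04Allowed helim hgood (hmod N f hf)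
  · exact hex S hfam f hfo hf
  · exact hst S .v₇ hstd rfl f hfo hf

end Summit.Ventures.AbcSig
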